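import Summits.ResolutionOfSingularities.ResolutionOfSingularities.Theorems.ValuativeLuAlphaPTorsorBirationalExit
import Literature.AlgebraicGeometry.Resolution.ResolutionLU
import Literature.AlgebraicGeometry.Resolution.AffineDomainDimension
import Literature.AlgebraicGeometry.Resolution.LocalUniformizationDimOne
import Literature.AlgebraicGeometry.Resolution.ExcellentRingsFieldProofs
import Literature.AlgebraicGeometry.Resolution.LocalUniformizationAbhyankarPlaces
import Mathlib.FieldTheory.IntermediateField.Adjoin.Algebra
import HarnessLib

/-!
# Known ranges of the crux `Valuative.LuAlphaPTorsor` (stmt-ResolutionOfSingularities-0641)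
# (line `pfaff-line-log-final-forms`: helper stubs `luAlphaPTorsor_of_relLocalUniformization`,
# `luAlphaPTorsor_of_trdeg_le_one`, `luAlphaPTorsor_of_trdeg_le_three_of_cossartPiltant2019`,
# `luAlphaPTorsor_of_isAbhyankarPlace_of_perfectField`)

Setting: `k` a field of characteristic `p`, `K ⊇ k` a field, `O` a valuation ring of `K`,
`A₀ ⊆ O` a finitely generated `k`-subalgebra, `t ∈ K` with `t ^ p ∈ A₀` and `Frac (A₀[t]) = K`.
The conclusion of the crux asks for a finitely generated `A ⊇ A₀[t]` inside `O` with
`Frac A = K`, regular at the centre `𝔪_O ∩ A`. The four theorems of this file record the ranges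
in which this conclusion is KNOWN (the regularity of the base `A₀` at the centre is not used in
any of them; `t ^ p ∈ A₀` is only used through `t ∈ O`, valuation rings being integrally closed):

* `luAlphaPTorsor_of_relLocalUniformization` — relative local uniformization of THIS `O`
  (`RelLocalUniformization k K O`, Novacoski–Spivakovsky 2014, Def. 2.20) gives the conclusion:
  apply it to the model `R := A₀[t] ⊆ O`.
* `luAlphaPTorsor_of_trdeg_le_one` — `trdeg_k K ≤ 1` (curves): UNCONDITIONAL, every `p`, every
  `k`. Local uniformization of excellent one-dimensional domains is finite normalisation
  (`exists_closure_isRegularLocalRing_of_ringKrullDim_le_one`, Kollár Thm. 1.101 / Stacks 0BXV),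
  and finitely generated algebras over a field are excellent (`Stacks07QW_field_holds`).
* `luAlphaPTorsor_of_trdeg_le_three_of_cossartPiltant2019` — `trdeg_k K ≤ 3`: conditional on
  the named fact `CossartPiltant2019` (resolution of quasi-excellent schemes of dimension `≤ 3`),
  through `CossartPiltant2019.lu3` and `CossartPiltant2019LU3.relLocalUniformization`.
* `luAlphaPTorsor_of_isAbhyankarPlace_of_perfectField` — `O` an ABHYANKAR place of `K/k` and `k`
  PERFECT, every dimension: Knaf–Kuhlmann 2005, Thm. 1.1 with Cor. 2.2 (the residue field
  extension of an Abhyankar place of a function field is finitely generated, hence separably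
  generated over a perfect field), in the tree as `relLU_at_abhyankarPlace_of_perfectField`.

These are ports of the kernel-checked `concl_of_relLU`, `concl_of_trdeg_le_one`,
`concl_of_trdeg_le_three`, `at_trdeg_le_one` of `Cruxes/LuAlphaPTorsor/Disproof.lean` §3c
(not importable from `Theorems/`), plus the perfect-field Abhyankar case.

Log: (1) direct port.
-/

-- single-problem summit: the doubled namespace component `ResolutionOfSingularities` is forced
set_option linter.dupNamespace false

open IsLocalRing

namespace Summit.ResolutionOfSingularities.ResolutionOfSingularities.Theorems.PfaffLine

open Literature.AlgebraicGeometry.Resolution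

section Helpers

variable {k K : Type} [Field k] [Field K] [Algebra k K]

-- adapted from Cruxes/LuAlphaPTorsor/Disproof.lean (§Helpers)
/-- The localisation of a Noetherian domain at the zero ideal is a regular local ring (it is a
field: its maximal ideal is `0`). -/
theorem isRegularLocalRing_localizationAtPrime_of_eq_bot {R : Type*} [CommRing R] [IsDomain R]
    [IsNoetherianRing R] (I : Ideal R) [I.IsPrime] (hI : I = ⊥) :
    IsRegularLocalRing (Localization.AtPrime I) := by
  subst hI
  apply IsRegularLocalRing.of_spanFinrank_maximalIdeal_le
  have hm : maximalIdeal (Localization.AtPrime (⊥ : Ideal R)) = ⊥ := by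
    rw [← Localization.AtPrime.map_eq_maximalIdeal, Ideal.map_bot]
  rw [hm, Submodule.spanFinrank_bot]
  exact ringKrullDim_nonneg_of_nontrivial

-- adapted from Cruxes/LuAlphaPTorsor/Disproof.lean (§3c `concl_of_relLU`)
/-- **Relative LU of `O` gives the conclusion of the crux** for every datum `(A₀, t)` over `O`
with `t ∈ O`: apply `RelLocalUniformization k K O` to the finitely generated model
`R := A₀[t] ⊆ O` (which has fraction field `K`). -/
theorem exists_regularModel_of_relLocalUniformization (O : ValuationSubring K)
    (H : RelLocalUniformization k K O) (A₀ : Subalgebra k K) (h₀ : A₀.toSubring ≤ O.toSubring)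
    (t : K) (hfg : A₀.FG) (htO : t ∈ O)
    (hfr : IsFractionRing (Algebra.adjoin k (insert t (A₀ : Set K))) K) :
    ∃ (A : Subalgebra k K) (h : A.toSubring ≤ O.toSubring), A₀ ≤ A ∧ t ∈ A ∧ A.FG ∧
      IsFractionRing A K ∧ IsRegularLocalRing (Localization.AtPrime
        (Ideal.comap (Subring.inclusion h) (IsLocalRing.maximalIdeal O))) := by
  have hRO := adjoin_insert_toSubring_le O.toSubring A₀ h₀ htO
  obtain ⟨A, h, hRA, hAfg, hreg⟩ := H _ (fg_adjoin_insert hfg t) hfr hRO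
  exact ⟨A, h, (le_adjoin_insert A₀ t).trans hRA, hRA (mem_adjoin_insert A₀ t), hAfg,
    isFractionRing_of_le hRA hfr, hreg⟩

-- adapted from Cruxes/LuAlphaPTorsor/Disproof.lean (§3c `concl_of_trdeg_le_one`)
/-- **Transcendence degree `≤ 1` (curves): the conclusion of the crux holds UNCONDITIONALLY**,
for every ground field `k` and every `t ∈ O`. Local uniformization of excellent one-dimensional
domains is finite normalization (`exists_closure_isRegularLocalRing_of_ringKrullDim_le_one`,
Kollár Thm. 1.101 / Stacks 0BXV), and finitely generated algebras over a field are excellent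
(`Stacks07QW_field_holds`); if the centre of `O` on `R = A₀[t]` is zero, `R` itself works. -/
theorem exists_regularModel_of_trdeg_le_one (hK : Algebra.trdeg k K ≤ 1)
    (O : ValuationSubring K) (A₀ : Subalgebra k K) (h₀ : A₀.toSubring ≤ O.toSubring) (t : K)
    (hfg : A₀.FG) (htO : t ∈ O)
    (hfr : IsFractionRing (Algebra.adjoin k (insert t (A₀ : Set K))) K) :
    ∃ (A : Subalgebra k K) (h : A.toSubring ≤ O.toSubring), A₀ ≤ A ∧ t ∈ A ∧ A.FG ∧
      IsFractionRing A K ∧ IsRegularLocalRing (Localization.AtPrime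
        (Ideal.comap (Subring.inclusion h) (IsLocalRing.maximalIdeal O))) := by
  classical
  set R : Subalgebra k K := Algebra.adjoin k (insert t (A₀ : Set K)) with hR
  have hRO : R.toSubring ≤ O.toSubring := adjoin_insert_toSubring_le O.toSubring A₀ h₀ htO
  have hRfg : R.FG := fg_adjoin_insert hfg t
  haveI : IsFractionRing R K := hfr
  haveI : IsNoetherianRing R.toSubring := isNoetherianRing_of_fg hRfg
  -- either the centre is `(0)` (then `R` itself works) or it contains some `b ≠ 0`
  by_cases hbot : Ideal.comap (Subring.inclusion hRO) (maximalIdeal O) = ⊥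
  · exact ⟨R, hRO, le_adjoin_insert A₀ t, mem_adjoin_insert A₀ t, hRfg, hfr,
      isRegularLocalRing_localizationAtPrime_of_eq_bot _ hbot⟩
  obtain ⟨b, hb, hb0⟩ : ∃ b ∈ Ideal.comap (Subring.inclusion hRO) (maximalIdeal O), b ≠ 0 := by
    by_contra! hcon
    exact hbot ((Submodule.eq_bot_iff _).mpr hcon)
  have hb0' : (b : K) ≠ 0 := fun h => hb0 (Subtype.ext h)
  have hvb : O.valuation (b : K) < 1 := (mem_subringCentre_iff hRO b).mp hb
  -- `R` is excellent of dimension `≤ 1` with fraction field `K`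
  haveI : Algebra.FiniteType k R := R.fg_iff_finiteType.mp hRfg
  have hexc : IsExcellentRing R.toSubring := Stacks07QW_field_holds k R inferInstance
  have hdim : ringKrullDim R.toSubring ≤ 1 :=
    ringKrullDim_le_of_fg_of_trdeg_le R hRfg (by exact_mod_cast hK)
  have hfrac : ∀ z : K, ∃ a s : R.toSubring, (s : K) ≠ 0 ∧ z * s = a := by
    intro z
    obtain ⟨a, s, hs, rfl⟩ := IsFractionRing.div_surjective (A := R) z
    have hs0 : (s : K) ≠ 0 := fun h => nonZeroDivisors.ne_zero hs (Subtype.ext h)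
    exact ⟨a, s, hs0, div_mul_cancel₀ _ hs0⟩
  obtain ⟨t', ht', hreg⟩ :=
    exists_closure_isRegularLocalRing_of_ringKrullDim_le_one O R.toSubring hexc hdim hRO hfrac
      hb0' hvb
  -- the model `A = R[t'] = R ⊔ k[t']`
  set A : Subalgebra k K := R ⊔ Algebra.adjoin k (t' : Set K) with hA
  have h1 : A = Algebra.adjoin k ((R : Set K) ∪ ↑t') := by
    rw [hA, Algebra.adjoin_union, Algebra.adjoin_eq]
  have heq : A.toSubring = Subring.closure ((R.toSubring : Set K) ∪ ↑t') := by
    rw [h1, Algebra.adjoin_eq_ring_closure]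
    apply le_antisymm
    · refine Subring.closure_le.mpr ?_
      rintro x (⟨c, rfl⟩ | hx)
      · exact Subring.subset_closure (Or.inl (R.algebraMap_mem c))
      · exact Subring.subset_closure hx
    · exact Subring.closure_mono Set.subset_union_right
  have hAO : A.toSubring ≤ O.toSubring := heq ▸ ht'
  have hRA : R ≤ A := le_sup_left
  refine ⟨A, hAO, (le_adjoin_insert A₀ t).trans hRA, hRA (mem_adjoin_insert A₀ t),
    hRfg.sup (Subalgebra.fg_adjoin_finset _), isFractionRing_of_le hRA hfr, ?_⟩
  exact (isRegularLocalRing_centre_congr heq hAO ht').mpr hreg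

/-- A field `K` with a finitely generated `k`-subalgebra `R` such that `Frac R = K` is a
finitely generated field extension of `k`. -/
theorem intermediateField_top_fg_of_isFractionRing (R : Subalgebra k K) (hRfg : R.FG)
    [IsFractionRing R K] : (⊤ : IntermediateField k K).FG := by
  haveI : Algebra.FiniteType k R := R.fg_iff_finiteType.mp hRfg
  haveI : Algebra.EssFiniteType R K :=
    Algebra.EssFiniteType.of_isLocalization K (nonZeroDivisors R)
  exact IntermediateField.fg_top_iff.mpr (Algebra.EssFiniteType.comp k R K)

end Helpers

/-! ## The four registered helper stubs -/

-- adapted from Cruxes/LuAlphaPTorsor/Disproof.lean (§1 `at_of_relLU`, pointwise in `O`)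
/-- **Relative local uniformization of `O` implies the crux at `O`** (helper stub
`luAlphaPTorsor_of_relLocalUniformization` of line `pfaff-line-log-final-forms`): apply
`RelLocalUniformization k K O` to the model `A₀[t] ⊆ O` (`t ∈ O` because `t ^ p ∈ A₀ ⊆ O` and
valuation rings are integrally closed). The regularity of the base is not used. -/
theorem luAlphaPTorsor_of_relLocalUniformization :
    ∀ p : ℕ, p.Prime → ∀ (k K : Type) [Field k] [CharP k p] [Field K] [Algebra k K] (O : ValuationSubring K) (A₀ : Subalgebra k K) (h₀ : A₀.toSubring ≤ O.toSubring) (t : K), A₀.FG → t ^ p ∈ A₀ → IsFractionRing (Algebra.adjoin k (insert t (A₀ : Set K))) K → Literature.AlgebraicGeometry.Resolution.RelLocalUniformization k K O → ∃ (A : Subalgebra k K) (h : A.toSubring ≤ O.toSubring), A₀ ≤ A ∧ t ∈ A ∧ A.FG ∧ IsFractionRing A K ∧ IsRegularLocalRing (Localization.AtPrime (Ideal.comap (Subring.inclusion h) (IsLocalRing.maximalIdeal O))) := by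
  intro p hp k K _ _ _ _ O A₀ h₀ t hfg htp hfr H
  exact exists_regularModel_of_relLocalUniformization O H A₀ h₀ t hfg
    (mem_valuationSubring_of_pow_mem O hp.ne_zero (h₀ htp)) hfr

-- adapted from Cruxes/LuAlphaPTorsor/Disproof.lean (§3c `at_trdeg_le_one`)
/-- **Transcendence degree `≤ 1` (curves): the crux holds UNCONDITIONALLY, for every `p` and every
ground field `k`** (helper stub `luAlphaPTorsor_of_trdeg_le_one`). Local uniformization of
excellent one-dimensional domains is finite normalization
(`exists_closure_isRegularLocalRing_of_ringKrullDim_le_one`), and finitely generated algebras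
over a field are excellent (`Stacks07QW_field_holds`). -/
theorem luAlphaPTorsor_of_trdeg_le_one :
    ∀ p : ℕ, p.Prime → ∀ (k K : Type) [Field k] [CharP k p] [Field K] [Algebra k K] (O : ValuationSubring K) (A₀ : Subalgebra k K) (h₀ : A₀.toSubring ≤ O.toSubring) (t : K), A₀.FG → t ^ p ∈ A₀ → IsFractionRing (Algebra.adjoin k (insert t (A₀ : Set K))) K → Algebra.trdeg k K ≤ 1 → ∃ (A : Subalgebra k K) (h : A.toSubring ≤ O.toSubring), A₀ ≤ A ∧ t ∈ A ∧ A.FG ∧ IsFractionRing A K ∧ IsRegularLocalRing (Localization.AtPrime (Ideal.comap (Subring.inclusion h) (IsLocalRing.maximalIdeal O))) := by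
  intro p hp k K _ _ _ _ O A₀ h₀ t hfg htp hfr hK
  exact exists_regularModel_of_trdeg_le_one hK O A₀ h₀ t hfg
    (mem_valuationSubring_of_pow_mem O hp.ne_zero (h₀ htp)) hfr

-- adapted from Cruxes/LuAlphaPTorsor/Disproof.lean (§3c `concl_of_trdeg_le_three`)
/-- **Transcendence degree `≤ 3`: the crux holds conditionally on the named fact
`CossartPiltant2019`** (resolution of quasi-excellent schemes of dimension `≤ 3`; helper stub
`luAlphaPTorsor_of_trdeg_le_three_of_cossartPiltant2019`), through the tree's
`CossartPiltant2019.lu3` and `CossartPiltant2019LU3.relLocalUniformization` and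
`luAlphaPTorsor_of_relLocalUniformization`. -/
theorem luAlphaPTorsor_of_trdeg_le_three_of_cossartPiltant2019 :
    Literature.AlgebraicGeometry.Resolution.CossartPiltant2019.{0} → ∀ p : ℕ, p.Prime → ∀ (k K : Type) [Field k] [CharP k p] [Field K] [Algebra k K] (O : ValuationSubring K) (A₀ : Subalgebra k K) (h₀ : A₀.toSubring ≤ O.toSubring) (t : K), A₀.FG → t ^ p ∈ A₀ → IsFractionRing (Algebra.adjoin k (insert t (A₀ : Set K))) K → Algebra.trdeg k K ≤ 3 → ∃ (A : Subalgebra k K) (h : A.toSubring ≤ O.toSubring), A₀ ≤ A ∧ t ∈ A ∧ A.FG ∧ IsFractionRing A K ∧ IsRegularLocalRing (Localization.AtPrime (Ideal.comap (Subring.inclusion h) (IsLocalRing.maximalIdeal O))) := by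
  intro hCP p hp k K _ _ _ _ O A₀ h₀ t hfg htp hfr hK
  exact exists_regularModel_of_relLocalUniformization O (hCP.lu3.relLocalUniformization k K hK O)
    A₀ h₀ t hfg (mem_valuationSubring_of_pow_mem O hp.ne_zero (h₀ htp)) hfr

/-- **The crux along every ABHYANKAR place over a PERFECT ground field, in every dimension —
unconditionally** (helper stub `luAlphaPTorsor_of_isAbhyankarPlace_of_perfectField`):
Knaf–Kuhlmann 2005, Thm. 1.1 with Cor. 2.2 give relative local uniformization at every Abhyankar
place of the finitely generated extension `K = Frac (A₀[t])` of the perfect field `k`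
(`relLU_at_abhyankarPlace_of_perfectField`); apply it to the model `A₀[t] ⊆ O`. -/
theorem luAlphaPTorsor_of_isAbhyankarPlace_of_perfectField :
    ∀ p : ℕ, p.Prime → ∀ (k K : Type) [Field k] [CharP k p] [PerfectField k] [Field K] [Algebra k K] (O : ValuationSubring K) (A₀ : Subalgebra k K) (h₀ : A₀.toSubring ≤ O.toSubring) (t : K), A₀.FG → t ^ p ∈ A₀ → IsFractionRing (Algebra.adjoin k (insert t (A₀ : Set K))) K → Literature.AlgebraicGeometry.Resolution.IsAbhyankarPlace O (algebraMap k K).fieldRange ⊤ → ∃ (A : Subalgebra k K) (h : A.toSubring ≤ O.toSubring), A₀ ≤ A ∧ t ∈ A ∧ A.FG ∧ IsFractionRing A K ∧ IsRegularLocalRing (Localization.AtPrime (Ideal.comap (Subring.inclusion h) (IsLocalRing.maximalIdeal O))) := by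
  intro p hp k K _ _ _ _ _ O A₀ h₀ t hfg htp hfr hAbh
  have htO : t ∈ O := mem_valuationSubring_of_pow_mem O hp.ne_zero (h₀ htp)
  have hRO : (Algebra.adjoin k (insert t (A₀ : Set K))).toSubring ≤ O.toSubring :=
    adjoin_insert_toSubring_le O.toSubring A₀ h₀ htO
  have hRfg : (Algebra.adjoin k (insert t (A₀ : Set K))).FG := fg_adjoin_insert hfg t
  haveI : IsFractionRing (Algebra.adjoin k (insert t (A₀ : Set K))) K := hfr
  have hKfg : (⊤ : IntermediateField k K).FG :=
    intermediateField_top_fg_of_isFractionRing (Algebra.adjoin k (insert t (A₀ : Set K))) hRfg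
  obtain ⟨A, h, hRA, hAfg, hfrA, hreg⟩ :=
    relLU_at_abhyankarPlace_of_perfectField hKfg O (fun c => h₀ (A₀.algebraMap_mem c)) hAbh
      (Algebra.adjoin k (insert t (A₀ : Set K))) hRfg hRO
  exact ⟨A, h, (le_adjoin_insert A₀ t).trans hRA, hRA (mem_adjoin_insert A₀ t), hAfg, hfrA,
    hreg⟩

end Summit.ResolutionOfSingularities.ResolutionOfSingularities.Theorems.PfaffLine
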